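import Summits.CriticalPhenomena.SAWScalingLimit.Theses.SAWTwistedSelfEnergy
import Summits.CriticalPhenomena.SAWScalingLimit.Cruxes.TwistedGapEquation.Misstatement
import HarnessLib

/-!
# Strategy census (typed part) for crux `DomainTransfer` (stmt-CriticalPhenomena-17875)

Route `route-CriticalPhenomena-SAWTwistedSelfEnergy`, crux
`DomainTransfer := TwistedKernelSummable → TwistedKernelTailIndex → TwistedGapEquation → ObservableLimitFlat`.
Crux-strategist seat `planner-cstrat-stmt-CriticalPhenomena-17875-b1-0`, 2026-08-17.  Companion prose:
`Cruxes/DomainTransfer/STRATEGY-CENSUS.md`.  Nothing here is a line or a stub; the file records, kernel-checked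
where cheap, the facts the census leans on:

* §0  STATUS — `domainTransfer_of_target : ObservableLimitFlat → DomainTransfer` (the shared target
  stmt-6855 closes this item by weakening) and an anonymous `example : DomainTransfer` (AS TYPED the crux is
  provable VACUOUSLY from `Misstatement.twistedGapEquation_false`; junk, never to be landed — MISSTATED.md of
  crux stmt-17874); `target_of_domainTransfer` (under the route's own three kernel bets the item IS the target).
* §1  STRENGTHEN / structural — `RotationCovariance` (ℤ₄-covariance of the twisted two-point matrices,
  provable now), `WholePlaneProfile` (the first lemma of the only technique that bites the kernel
  hypotheses: Tauberian inversion of the matrix symbol — a WHOLE-PLANE statement), `NoHolomorphicProfile`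
  (Mathlib-provable: a holomorphic function on `ℂ ∖ 0`, homogeneous of non-integer real degree, vanishes) —
  together: the whole-plane data select angular momenta, they never express Cauchy–Riemann.
* §2  DECOMPOSITION — the best typed split: `DomainResolventIdentity` (domain kernel exists uniquely:
  bookkeeping, provable now), `BoundaryPhase` (discrete Umlaufsatz: the exit phase at a boundary edge is
  walk-independent, provable now), `BulkBoundaryAnalysis` (the remainder — literally the crux again), and the
  trivial glue `domainTransfer_of_subs`.
-/

noncomputable section

open Filter Topology
open scoped BigOperators Topology Classical Matrix
open Literature.Probability.RandomPlanarGeometry Literature.Probability.LatticeModels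

namespace Summit.CriticalPhenomena.SAWScalingLimit.Cruxes.DomainTransfer.Census

open Summit.CriticalPhenomena.SAWScalingLimit.Theses.SAWTwistedSelfEnergy
open Summit.CriticalPhenomena.SAWScalingLimit.Cruxes.TwistedGapEquation.Misstatement

/-! ## §0  Status of the crux as typed -/

/-- The shared target (stmt-CriticalPhenomena-6855) closes the crux by weakening: every line on
`ObservableLimitFlat` is already a line on `DomainTransfer`. -/
theorem domainTransfer_of_target (h : ObservableLimitFlat) : DomainTransfer :=
  fun _ _ _ => h

/-- The vacuity channel: a false kernel hypothesis proves the crux with no content. -/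
theorem domainTransfer_of_not_gap (h : ¬ TwistedGapEquation) : DomainTransfer :=
  fun _ _ h₃ => (h h₃).elim

/-- **AS TYPED (route rev 2) the crux is provable vacuously** — `TwistedGapEquation` is false as typed
(`Misstatement.twistedGapEquation_false`, sorry-free, crux stmt-17874 workfiles).  JUNK: not to be landed;
after the pending restate R1 (`K 0 = 0 ∧ …`, same decl name) this proof stops compiling and the item regains
its content. -/
example : DomainTransfer :=  -- `domainTransfer_asTyped`, deliberately anonymous: never to be harvested
  domainTransfer_of_not_gap twistedGapEquation_false

/-- Under the route's own three kernel bets the item IS the target: modus ponens. -/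
theorem target_of_domainTransfer (h : DomainTransfer) (h₁ : TwistedKernelSummable)
    (h₂ : TwistedKernelTailIndex) (h₃ : TwistedGapEquation) : ObservableLimitFlat :=
  h h₁ h₂ h₃

/-! ## §1  Strengthen / structure of the hypotheses

Vocabulary `dir`, `spin`, `stepMatrix`, `twoPoint`, `IsTwistedKernel`, `kstar` = the route's `let`s,
letter for letter (`Misstatement.crux_iff` is `Iff.rfl`). -/

/-- The quarter-turn `z ↦ iz` on `ℤ²`. -/
def rot (z : Site 2) : Site 2 := ![-(z 1), z 0]

/-- **ℤ₄-covariance of the twisted two-point matrices** (provable now by transporting paths along the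
graph automorphism `rot` of `zdGraph 2`: `rot (dir k) = dir (k+1)`, turning angles are rotation
invariant, `IsPath`/length/endpoint conditions are preserved): `G_n(iz)(ι+1, κ+1) = G_n(z)(ι, κ)`.
Consequence used in the census: in the rotation sectors `[s, s']` the component of any scaling profile
has INTEGER angular momenta `≡ s' - s (mod 4)`; the diagonal sectors are ℤ₄-invariant. -/
def RotationCovariance : Prop :=
  ∀ (n : ℕ) (z : Site 2) (ι κ : Fin 4), twoPoint n (rot z) (ι + 1) (κ + 1) = twoPoint n z ι κ

/-- The critical whole-plane twisted two-point matrix `G(z) = Σ_n x_c^n G_n(z)` (a `tsum`; junk `0` if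
not summable — its summability at `x_c` for `z ≠ 0` is itself part of the route's bets). -/
def green (z : Site 2) : Matrix (Fin 4) (Fin 4) ℂ :=
  ∑' n : ℕ, (SAW.criticalFugacity : ℂ) ^ n • twoPoint n z

/-- **First lemma of the one technique that bites the kernel hypotheses** (Tauberian inversion of the
matrix symbol `M(k) = I - x_c T̂(k) - K̂(k)`, Slade 2006 §4 / NoBLE arXiv:1506.07969 Thm 1.3-type):
the whole-plane critical twisted function has a scaling profile — an exponent `a` and a non-zero
continuous angular matrix profile `Φ` on the unit circle with `|z|^a G(z)(ι,κ) - Φ(z/|z|)(ι,κ) → 0` at infinity (entrywise, along the cofinite filter of `ℤ²`).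
(The route's numbers: `a = 2σ = 5/4` from kernel abscissa `3/4`; chiral purity = `Φ` a single harmonic
per sector.)  It is a WHOLE-PLANE statement: it belongs to `TwistedKernelTailIndex`/`ChiralTail`, and by
`RotationCovariance` + `NoHolomorphicProfile` it carries no Cauchy–Riemann content. -/
def WholePlaneProfile : Prop :=
  ∃ (a : ℝ) (Φ : ℂ → Matrix (Fin 4) (Fin 4) ℂ),
    ContinuousOn Φ (Metric.sphere (0 : ℂ) 1) ∧ (∃ w ∈ Metric.sphere (0 : ℂ) 1, Φ w ≠ 0) ∧
    ∀ ι κ : Fin 4, Tendsto (fun z : Site 2 =>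
        ((‖Site.toComplex z‖ ^ a : ℝ) : ℂ) * green z ι κ -
          Φ (((‖Site.toComplex z‖⁻¹ : ℝ) : ℂ) * Site.toComplex z) ι κ)
      Filter.cofinite (𝓝 0)

/-- **No holomorphic scaling profile of non-integer degree** (Mathlib-provable, M-sized; Euler's
identity `z f' = -a f` on `ℂ ∖ 0`, `f = c z^{-a}` on the slit plane, single-valuedness across the cut
forces `c = 0` since `e^{2πia} ≠ 1`): a function holomorphic on the punctured plane and homogeneous of
real-dilation degree `-a`, `a ∉ ℤ`, vanishes identically.  With `a = 5/4` (or any non-integer decay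
exponent) the whole-plane scaling profile `|z|^{-a} Φ(z/|z|)_{ικ}` is therefore NEVER holomorphic:
"chiral purity of the tail" is an angular-momentum selection rule, not the missing half of
Cauchy–Riemann. -/
def NoHolomorphicProfile : Prop :=
  ∀ (a : ℝ) (f : ℂ → ℂ), (∀ n : ℤ, a ≠ n) → DifferentiableOn ℂ f {0}ᶜ →
    (∀ t : ℝ, 0 < t → ∀ z : ℂ, z ≠ 0 → f ((t : ℂ) * z) = ((t : ℂ) ^ (-(a : ℂ))) * f z) →
    ∀ z : ℂ, z ≠ 0 → f z = 0

/-- **`NoHolomorphicProfile` holds** (sorry-free): Euler's identity `w f'(w) = -a f(w)` from the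
real-dilation homogeneity, then `θ ↦ f(z e^{iθ}) e^{iaθ}` has zero derivative on `ℝ`, hence is constant;
comparing `θ = 0` and `θ = 2π` gives `f z · (e^{2πia} - 1) = 0`, and `e^{2πia} ≠ 1` for `a ∉ ℤ`. -/
theorem noHolomorphicProfile_holds : NoHolomorphicProfile := by
  intro a f ha hf hhom z hz
  -- (1) Euler's identity on the punctured plane
  have euler : ∀ w : ℂ, w ≠ 0 → w * deriv f w = -(a : ℂ) * f w := by
    intro w hw
    have hdf : DifferentiableAt ℂ f w :=
      hf.differentiableAt (isOpen_compl_singleton.mem_nhds hw)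
    -- derivative at `t = 1` of `t ↦ f (t w)` (real `t`)
    have h1 : HasDerivAt (fun t : ℝ => f ((t : ℂ) * w)) (deriv f w * w) 1 := by
      have hm : HasDerivAt (fun ζ : ℂ => ζ * w) w (((1 : ℝ) : ℂ)) := by
        simpa using (hasDerivAt_id (((1 : ℝ) : ℂ))).mul_const w
      have hfw : HasDerivAt f (deriv f w) ((((1 : ℝ) : ℂ)) * w) := by
        rw [Complex.ofReal_one, one_mul]; exact hdf.hasDerivAt
      exact (HasDerivAt.comp (((1 : ℝ) : ℂ)) hfw hm).comp_ofReal
    -- derivative at `t = 1` of `t ↦ t^{-a} f(w)`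
    have h2 : HasDerivAt (fun t : ℝ => ((t : ℂ) ^ (-(a : ℂ))) * f w)
        ((-(a : ℂ)) * (((1 : ℝ) : ℂ)) ^ (-(a : ℂ) - 1) * 1 * f w) 1 := by
      have hc : HasDerivAt (fun ζ : ℂ => ζ ^ (-(a : ℂ)))
          ((-(a : ℂ)) * (((1 : ℝ) : ℂ)) ^ (-(a : ℂ) - 1) * 1) (((1 : ℝ) : ℂ)) := by
        have hs : (fun ζ : ℂ => ζ) (((1 : ℝ) : ℂ)) ∈ Complex.slitPlane := by
          simp [Complex.one_mem_slitPlane]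
        exact (hasDerivAt_id (((1 : ℝ) : ℂ))).cpow_const hs
      exact hc.comp_ofReal.mul_const (f w)
    -- the two functions agree near `t = 1`
    have hev : (fun t : ℝ => f ((t : ℂ) * w)) =ᶠ[𝓝 (1 : ℝ)]
        (fun t : ℝ => ((t : ℂ) ^ (-(a : ℂ))) * f w) := by
      filter_upwards [Ioi_mem_nhds (zero_lt_one' ℝ)] with t ht
      exact hhom t ht w hw
    have h3 := (h1.congr_of_eventuallyEq hev.symm).unique h2
    -- hmm: congr_of_eventuallyEq : HasDerivAt f f' x → f₁ =ᶠ f → HasDerivAt f₁ f' x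
    simp only [Complex.ofReal_one, Complex.one_cpow, mul_one] at h3
    linear_combination h3
  -- (2) the rotation ODE: ψ θ = f (z e^{iθ}) e^{iaθ} has zero derivative
  set ψ : ℝ → ℂ := fun θ =>
    f (z * Complex.exp (Complex.I * θ)) * Complex.exp (Complex.I * a * θ) with hψdef
  have hψ : ∀ θ : ℝ, HasDerivAt ψ 0 θ := by
    intro θ
    have hw : z * Complex.exp (Complex.I * θ) ≠ 0 := mul_ne_zero hz (Complex.exp_ne_zero _)
    have hdf : DifferentiableAt ℂ f (z * Complex.exp (Complex.I * θ)) :=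
      hf.differentiableAt (isOpen_compl_singleton.mem_nhds hw)
    have hin : HasDerivAt (fun ζ : ℂ => z * Complex.exp (Complex.I * ζ))
        (z * (Complex.exp (Complex.I * θ) * (Complex.I * 1))) (θ : ℂ) :=
      (((hasDerivAt_id (θ : ℂ)).const_mul Complex.I).cexp).const_mul z
    have hF : HasDerivAt (fun ζ : ℂ => f (z * Complex.exp (Complex.I * ζ)))
        (deriv f (z * Complex.exp (Complex.I * θ)) *
          (z * (Complex.exp (Complex.I * θ) * (Complex.I * 1)))) (θ : ℂ) :=
      HasDerivAt.comp (θ : ℂ) hdf.hasDerivAt hin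
    have hE : HasDerivAt (fun ζ : ℂ => Complex.exp (Complex.I * a * ζ))
        (Complex.exp (Complex.I * a * θ) * (Complex.I * a * 1)) (θ : ℂ) :=
      ((hasDerivAt_id (θ : ℂ)).const_mul (Complex.I * a)).cexp
    have hprod : HasDerivAt ψ
        (deriv f (z * Complex.exp (Complex.I * θ)) *
            (z * (Complex.exp (Complex.I * θ) * (Complex.I * 1))) * Complex.exp (Complex.I * a * θ) +
          f (z * Complex.exp (Complex.I * θ)) *
            (Complex.exp (Complex.I * a * θ) * (Complex.I * a * 1))) θ :=
      (hF.mul hE).comp_ofReal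
    have heu := euler _ hw
    refine hprod.congr_deriv ?_
    linear_combination (Complex.I * Complex.exp (Complex.I * a * θ)) * heu
  -- (3) ψ is constant on ℝ
  have hdψ : Differentiable ℝ ψ := fun θ => (hψ θ).differentiableAt
  have hconst : ψ (2 * Real.pi) = ψ 0 :=
    is_const_of_deriv_eq_zero hdψ (fun θ => (hψ θ).deriv) (2 * Real.pi) 0
  -- (4) evaluate at 0 and 2π
  have e1 : Complex.exp (Complex.I * (2 * (Real.pi : ℂ))) = 1 := by
    rw [show Complex.I * (2 * (Real.pi : ℂ)) = 2 * Real.pi * Complex.I by ring]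
    exact Complex.exp_two_pi_mul_I
  have hc' : f z * Complex.exp (Complex.I * a * (2 * (Real.pi : ℂ))) = f z := by
    have h := hconst
    simp only [hψdef] at h
    push_cast at h
    simp only [e1, mul_one, mul_zero, Complex.exp_zero] at h
    exact h
  have hne : Complex.exp (Complex.I * a * (2 * (Real.pi : ℂ))) ≠ 1 := by
    intro h1
    obtain ⟨n, hn⟩ := Complex.exp_eq_one_iff.1 h1
    have han : (a : ℂ) * (2 * Real.pi * Complex.I) = n * (2 * Real.pi * Complex.I) := by
      linear_combination hn
    have := mul_right_cancel₀ Complex.two_pi_I_ne_zero han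
    exact ha n (by exact_mod_cast this)
  have : f z * (Complex.exp (Complex.I * a * (2 * (Real.pi : ℂ))) - 1) = 0 := by
    linear_combination hc'
  rcases mul_eq_zero.1 this with h | h
  · exact h
  · exact absurd (sub_eq_zero.1 h) hne

/-- The only honest STRENGTHENING that still feeds `closes`: drop the hypotheses — i.e. the target
itself (stmt-6855, lines registered there: `Cruxes/ObservableLimitFlat/Lines/birth.lean`). -/
theorem strengthen_is_target : (ObservableLimitFlat → DomainTransfer) ∧
    (TwistedKernelSummable → TwistedKernelTailIndex → TwistedGapEquation →
      (DomainTransfer ↔ ObservableLimitFlat)) :=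
  ⟨domainTransfer_of_target, fun h₁ h₂ h₃ => ⟨fun h => h h₁ h₂ h₃, fun h _ _ _ => h⟩⟩

/-! ## §2  Decomposition — the best typed split -/

/-- Domain twisted two-point matrices `G^Ω_n(u, z)(ι, κ)`: self-avoiding walks of `Ω_δ` from `u` to `z`
of length `n`, fictitious incoming direction `ι` at `u` (first step `≠ -e_ι`), last step `e_κ`, weight
`e^{-iσW}` with the fictitious turn included — the route's `G` with `zdGraph 2` replaced by
`discreteDomainGraph Ω δ` (a `tsum` over the library's `SAW.DomainSAW`; finite sum for bounded `Ω`). -/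
def domainTwoPoint (Ω : Set ℂ) (δ : ℝ) (u : Site 2) (n : ℕ) (z : Site 2) :
    Matrix (Fin 4) (Fin 4) ℂ := fun ι κ =>
  if n = 0 then (if z = u ∧ ι = κ then 1 else 0) else
    ∑' γ : SAW.DomainSAW Ω δ u z,
      if γ.length = n ∧ γ.walk.getVert 1 ≠ u - dir ι ∧ z - γ.walk.getVert (n - 1) = dir κ then
        Complex.exp (-Complex.I * spin *
          (winding ((Site.toComplex (u - dir ι)) :: (γ.walk.support.map Site.toComplex)) : ℝ))
      else 0

/-- The DOMAIN self-energy of root `u`: `K^Ω_m(y)` (chains from `u` to `y` inside `Ω_δ`), defined —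
exactly like the route's whole-plane kernel after repair R1 — as the unique solution of the square
resolvent recursion in `Ω_δ` (free twisted step restricted to edges of `Ω_δ`, kernel on the left). -/
def IsDomainKernel (Ω : Set ℂ) (δ : ℝ) (u : Site 2)
    (K : ℕ → Site 2 → Matrix (Fin 4) (Fin 4) ℂ) : Prop :=
  K 0 = 0 ∧ (∀ n y, y ∉ meshDomain Ω δ → 1 ≤ n → K n y = 0) ∧
    ∀ n, 1 ≤ n → ∀ z, domainTwoPoint Ω δ u n z =
      Matrix.of (fun ι κ => if (discreteDomainGraph Ω δ).Adj (z - dir κ) z then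
          ∑ κ' : Fin 4, domainTwoPoint Ω δ u (n - 1) (z - dir κ) ι κ' * stepMatrix κ' κ else 0) +
        ∑ m ∈ Finset.Icc 1 n, ∑' y : Site 2, K m y * domainTwoPoint Ω δ y (n - m) z

/-- **Sub₁ (bookkeeping, provable now, M):** for a bounded domain the domain kernel exists and is unique
(the `m = n` term of the recursion is `K n z` since `G^Ω_0(y, z) = δ_{yz} I`: a triangular system, solved
level by level as `Misstatement.kstar` does in the whole plane).  Content-free w.r.t. the limit. -/
def DomainResolventIdentity : Prop :=
  ∀ (Ω : Set ℂ) (δ : ℝ) (u : Site 2), 0 < δ → Bornology.IsBounded Ω →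
    ∃! K : ℕ → Site 2 → Matrix (Fin 4) (Fin 4) ℂ, IsDomainKernel Ω δ u K

/-- **Sub₂ (discrete Umlaufsatz, provable now, M; DCS 2012 §4, p. 7: "the winding of an arc to a
boundary edge is uniquely determined, and coincides with the winding of the boundary itself"; tree
technology `HexSAWHopfPath`, `YangBaxterSAWBoundaryWinding`):** for a Jordan domain, a root `a ∈ Ω_δ`
entered from an outside neighbour `a'` and a boundary edge `(p, q)` (`p ∈ Ω_δ`, `δq ∉ Ω`), the exit
phase `e^{-iσW}` of the `let H` of `ObservableLimitFlat` is the SAME for every self-avoiding walk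
`a → p` of `Ω_δ`.  This is the exact lattice Riemann–Hilbert datum `arg F = -(5/8)·(normal angle)`;
shared by every observable route; not where the difficulty lives. -/
def BoundaryPhase : Prop :=
  ∀ (D : DobrushinDomain) (δ : ℝ) (a a' p q : Site 2), 0 < δ →
    a ∈ meshDomain D.carrier δ → (zdGraph 2).Adj a a' → meshPoint δ a' ∉ D.carrier →
    p ∈ meshDomain D.carrier δ → (zdGraph 2).Adj p q → meshPoint δ q ∉ D.carrier →
    ∃ c : ℂ, ‖c‖ = 1 ∧ ∀ γ : SAW.DomainSAW D.carrier δ a p,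
      Complex.exp (-Complex.I * (5 / 8 : ℂ) *
        (winding (meshPoint δ a' :: (γ.walk.support.map (meshPoint δ)) ++ [medialPoint δ s(p, q)]) : ℝ))
        = c

/-- **Sub₃ — what is left after peeling Sub₁ and Sub₂: the crux again.**  Interior ("∂̄f = 0 off the
root") AND boundary ("f = λ(φ′)^{5/8}") analysis of `M_Ω = I - x_c τ_Ω - K^Ω` from WHOLE-PLANE data on
`K`.  The census (STRATEGY-CENSUS.md §Decomposition, §Transfer) records why no typed intermediate
statement strictly between the kernel cruxes and `ObservableLimitFlat` is available: `K^Ω - K` is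
leading order at every scale near `∂Ω` (no first moment ⇒ no boundary layer), the whole-plane profile is
never holomorphic (§1), and the only content-bearing split of the conclusion (interior covariance ×
flat-boundary matching) is registered on stmt-6855 already. -/
def BulkBoundaryAnalysis : Prop :=
  DomainResolventIdentity → BoundaryPhase → DomainTransfer

/-- The glue of the split is trivial — which is the point: `BulkBoundaryAnalysis` is the whole crux. -/
theorem domainTransfer_of_subs (h₁ : DomainResolventIdentity) (h₂ : BoundaryPhase)
    (h₃ : BulkBoundaryAnalysis) : DomainTransfer :=
  h₃ h₁ h₂

/-! ## §3  Sanity: the route's kernel exists (so after R1 the hypotheses are about ONE explicit object) -/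

/-- After repair R1 the kernel hypotheses speak about the single explicit kernel `K⋆ = kstar`
(`Misstatement.kstar_isTwistedKernel_repaired`); e.g. `TwistedKernelSummable` becomes the summability of
one explicit family.  Recorded to make plain that the hypotheses of `DomainTransfer` are three numerical
facts about one translation-invariant whole-plane sequence of matrices — no domain, no boundary, no root. -/
example : kstar 0 = 0 ∧ IsTwistedKernel kstar := kstar_isTwistedKernel_repaired

end Summit.CriticalPhenomena.SAWScalingLimit.Cruxes.DomainTransfer.Census
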